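import Literature.Geometry.Manifold.RechartDifferential
import Literature.Geometry.Manifold.FreeCircleAction
import HarnessLib

/-!
# The product `N × ℂ` of a manifold with a circle action, recharted on `ℝᵏ⁺²`, and its
# diagonal circle action

Infrastructure for step (S2)/(S3) of the unfolding of an origami manifold (Cannas da Silva–
Guillemin–Pires, *Symplectic Origami*, IMRN 2011 = arXiv:0909.4065, §2.3 and proof of Prop. 2.8:
the symplectic cut of the collar `Z × (-ε, ε)` is the reduced space of `Z × (-ε, ε) × ℂ` for the
DIAGONAL circle action, i.e. the associated disc bundle `Z ×_{S¹} ℂ` over the base `B = Z/S¹`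
of the null fibration).  The tree's quotient-manifold theorem for free circle actions
(`Literature/Geometry/Manifold/FreeCircleQuotient*.lean`, Lee 2012, Thm. 21.10 with `G = S¹`) is
stated for manifolds charted on a Euclidean model `ℝᵐ`, whereas `N × ℂ` comes charted on
`ModelProd ℝᵏ ℂ`; this file therefore recharts the product on `ℝᵏ⁺²`
(`Literature.Geometry.Manifold.Rechart`, along the linear isomorphism `ℝᵏ × ℂ ≃ ℝᵏ⁺²`) and
sets up, on the recharted copy `ProdC k N`:

* `prodCModelIso k : ℝᵏ × ℂ ≃L[ℝ] ℝᵏ⁺²`, `prodCModel k` (the change of model) and its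
  smoothness both ways; `ProdC k N = Rechart (prodCModel k) (N × ℂ)`, a `C^∞` manifold for
  `𝓡 (k + 2)` (`ProdC.instIsManifold`), Hausdorff / σ-compact with `N`;
* the structure maps `ProdC.mk : N → ℂ → ProdC k N`, `ProdC.fst`, `ProdC.snd` (smooth:
  `contMDiff_mk`, `contMDiff_fst`, `contMDiff_snd`, and composition forms) and their
  differentials through the frame `L = prodCModelIso k` (`mfderiv_mkUncurry`, `mfderiv_fst`,
  `mfderiv_snd`, `mfderiv_fst_tangentLift`, …; `tangentLift v w = L (v, w)`);
* **the diagonal circle action** `a • mk n w = mk (a • n) (a w)` (`ProdC.instMulAction`, the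
  product of the given action on `N` with the multiplication action of `S¹ ⊂ ℂ`): it is `C^∞`
  when the action on `N` is (`contMDiff_smul_prodC`) and free when the action on `N` is
  (`smul_eq_self_prodC`), so that the orbit space `ProdC k N / S¹ = N ×_{S¹} ℂ` is a `C^∞`
  `(k+1)`-manifold by `isManifold_circleQuotient` (sequel).

Everything here is proved; the definitions are explicit constructions; no facts.

## References

* A. Cannas da Silva, V. Guillemin, A. R. Pires, *Symplectic Origami*, IMRN 2011 =
  arXiv:0909.4065, §2.3, Prop. 2.8. [CannasdasilvaGuilleminPires2010]
* J. M. Lee, *Introduction to Smooth Manifolds*, 2nd ed. (2012), Thm. 21.10, Example 21.31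
  (associated bundles as quotients of free actions). [LeeSmoothManifolds2013]
-/

noncomputable section

open scoped Manifold ContDiff Topology
open Set Function Filter

namespace Literature.Geometry.Manifold

/-! ### The change of model `ℝᵏ × ℂ ≃ ℝᵏ⁺²` -/

/-- `dim (ℝᵏ × ℂ) = k + 2 = dim ℝᵏ⁺²`. [folklore] -/
theorem finrank_prodCModel (k : ℕ) :
    Module.finrank ℝ (EuclideanSpace ℝ (Fin k) × ℂ) =
      Module.finrank ℝ (EuclideanSpace ℝ (Fin (k + 2))) := by
  rw [Module.finrank_prod, finrank_euclideanSpace_fin, finrank_euclideanSpace_fin,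
    Complex.finrank_real_complex]

/-- A linear isomorphism `ℝᵏ × ℂ ≃L[ℝ] ℝᵏ⁺²` (a choice). [folklore] -/
def prodCModelIso (k : ℕ) : (EuclideanSpace ℝ (Fin k) × ℂ) ≃L[ℝ] EuclideanSpace ℝ (Fin (k + 2)) :=
  ContinuousLinearEquiv.ofFinrankEq (finrank_prodCModel k)

/-- The same isomorphism as a change of model `ModelProd ℝᵏ ℂ ≃ₜ ℝᵏ⁺²`. [folklore] -/
def prodCModel (k : ℕ) : ModelProd (EuclideanSpace ℝ (Fin k)) ℂ ≃ₜ EuclideanSpace ℝ (Fin (k + 2)) :=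
  (prodCModelIso k).toHomeomorph

/-- The change of model reads `L` through the product model with corners (definitional).
[folklore] -/
theorem prodCModel_apply (k : ℕ) (x : ModelProd (EuclideanSpace ℝ (Fin k)) ℂ) :
    prodCModel k x = prodCModelIso k (((𝓡 k).prod 𝓘(ℝ, ℂ)) x) :=
  rfl

/-- The change of model is `C^∞`. [folklore] -/
theorem contMDiff_prodCModel (k : ℕ) :
    ContMDiff ((𝓡 k).prod 𝓘(ℝ, ℂ)) 𝓘(ℝ, EuclideanSpace ℝ (Fin (k + 2))) ∞ (prodCModel k) :=
  Rechart.contMDiff_of_apply_eq_linear _ (prodCModelIso k) fun _ ↦ rfl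

/-- The inverse change of model is `C^∞`. [folklore] -/
theorem contMDiff_prodCModel_symm (k : ℕ) :
    ContMDiff 𝓘(ℝ, EuclideanSpace ℝ (Fin (k + 2))) ((𝓡 k).prod 𝓘(ℝ, ℂ)) ∞ (prodCModel k).symm :=
  Rechart.contMDiff_symm_of_apply_eq_linear _ (prodCModelIso k) fun _ ↦ rfl

/-! ### The recharted product `ProdC k N` -/

/-- **`N × ℂ` recharted on `ℝᵏ⁺²`** (a type synonym of `N × ℂ` carrying the transported
atlas). [folklore] -/
abbrev ProdC (k : ℕ) (N : Type*) [TopologicalSpace N] [ChartedSpace (EuclideanSpace ℝ (Fin k)) N] :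
    Type _ :=
  Rechart (prodCModel k) (N × ℂ)

namespace ProdC

variable {k : ℕ} {N : Type*} [TopologicalSpace N] [ChartedSpace (EuclideanSpace ℝ (Fin k)) N]

/-- The point `(n, w)` of `ProdC k N`. [folklore] -/
def mk (n : N) (w : ℂ) : ProdC k N := Rechart.into (prodCModel k) (N × ℂ) (n, w)

/-- The first projection `ProdC k N → N`. [folklore] -/
def fst (p : ProdC k N) : N := (Rechart.out (prodCModel k) (N × ℂ) p).1

/-- The second projection `ProdC k N → ℂ`. [folklore] -/
def snd (p : ProdC k N) : ℂ := (Rechart.out (prodCModel k) (N × ℂ) p).2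

/-- `fst (mk n w) = n`. [folklore] -/
@[simp] theorem fst_mk (n : N) (w : ℂ) : fst (mk n w : ProdC k N) = n := rfl

/-- `snd (mk n w) = w`. [folklore] -/
@[simp] theorem snd_mk (n : N) (w : ℂ) : snd (mk n w : ProdC k N) = w := rfl

/-- `mk (fst p) (snd p) = p`. [folklore] -/
@[simp] theorem mk_fst_snd (p : ProdC k N) : mk (fst p) (snd p) = p := rfl

/-- `mk` is `into` on pairs. [folklore] -/
theorem mk_eq_into (n : N) (w : ℂ) :
    (mk n w : ProdC k N) = Rechart.into (prodCModel k) (N × ℂ) (n, w) := rfl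

/-- `out p = (fst p, snd p)`. [folklore] -/
theorem out_eq (p : ProdC k N) : Rechart.out (prodCModel k) (N × ℂ) p = (fst p, snd p) := rfl

/-- Two points with the same projections are equal. [folklore] -/
theorem ext {p q : ProdC k N} (h1 : fst p = fst q) (h2 : snd p = snd q) : p = q := by
  rw [← mk_fst_snd p, ← mk_fst_snd q, h1, h2]

/-- `mk` is injective in both arguments jointly. [folklore] -/
theorem mk_eq_mk_iff {n n' : N} {w w' : ℂ} :
    (mk n w : ProdC k N) = mk n' w' ↔ n = n' ∧ w = w' := by
  constructor
  · intro h
    exact ⟨by simpa using congrArg fst h, by simpa using congrArg snd h⟩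
  · rintro ⟨rfl, rfl⟩
    rfl

/-- Every point is of the form `mk n w`. [folklore] -/
theorem mk_surjective : Surjective (fun p : N × ℂ => (mk p.1 p.2 : ProdC k N)) := fun p =>
  ⟨(fst p, snd p), mk_fst_snd p⟩

/-! #### Topology -/

/-- `mk` is continuous (jointly). [folklore] -/
theorem continuous_mkUncurry : Continuous fun p : N × ℂ => (mk p.1 p.2 : ProdC k N) :=
  Rechart.continuous_into _ _

/-- `fst` is continuous. [folklore] -/
theorem continuous_fst : Continuous (fst : ProdC k N → N) :=
  _root_.continuous_fst.comp (Rechart.continuous_out _ _)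

/-- `snd` is continuous. [folklore] -/
theorem continuous_snd : Continuous (snd : ProdC k N → ℂ) :=
  _root_.continuous_snd.comp (Rechart.continuous_out _ _)

/-- `ProdC k N` is homeomorphic to `N × ℂ` through `(fst, snd)` / `mk`. [folklore] -/
def homeomorphProd : ProdC k N ≃ₜ N × ℂ := Rechart.outHomeomorph (prodCModel k) (N × ℂ)

/-- `homeomorphProd p = (fst p, snd p)`. [folklore] -/
@[simp] theorem homeomorphProd_apply (p : ProdC k N) : homeomorphProd p = (fst p, snd p) := rfl

/-- `homeomorphProd.symm (n, w) = mk n w`. [folklore] -/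
@[simp] theorem homeomorphProd_symm_apply (x : N × ℂ) : (homeomorphProd (k := k) (N := N)).symm x = mk x.1 x.2 :=
  rfl

/-- `ProdC k N` is Hausdorff when `N` is. [folklore] -/
instance instT2Space [T2Space N] : T2Space (ProdC k N) := Rechart.instT2Space _ _

/-- `ProdC k N` is σ-compact when `N` is. [folklore] -/
instance instSigmaCompactSpace [SigmaCompactSpace N] : SigmaCompactSpace (ProdC k N) :=
  Rechart.instSigmaCompactSpace _ _

/-- `ProdC k N` is second countable when `N` is. [folklore] -/
instance instSecondCountableTopology [SecondCountableTopology N] :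
    SecondCountableTopology (ProdC k N) :=
  (homeomorphProd (k := k) (N := N)).secondCountableTopology

/-! #### Smooth structure -/

variable [IsManifold (𝓡 k) ∞ N]

/-- **`ProdC k N` is a `C^∞` manifold modelled on `ℝᵏ⁺²`.** [folklore] -/
instance instIsManifold : IsManifold (𝓡 (k + 2)) ∞ (ProdC k N) :=
  Rechart.isManifold _ _ (contMDiff_prodCModel k) (contMDiff_prodCModel_symm k)

/-- `mk` is `C^∞` jointly (it is the identity `into`). [folklore] -/
theorem contMDiff_mkUncurry :
    ContMDiff ((𝓡 k).prod 𝓘(ℝ, ℂ)) (𝓡 (k + 2)) ∞ fun p : N × ℂ => (mk p.1 p.2 : ProdC k N) :=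
  Rechart.contMDiff_into _ _ (contMDiff_prodCModel k) (contMDiff_prodCModel_symm k)

/-- `out = (fst, snd)` is `C^∞`. [folklore] -/
theorem contMDiff_out :
    ContMDiff (𝓡 (k + 2)) ((𝓡 k).prod 𝓘(ℝ, ℂ)) ∞ (Rechart.out (prodCModel k) (N × ℂ)) :=
  Rechart.contMDiff_out _ _ (contMDiff_prodCModel k) (contMDiff_prodCModel_symm k)

/-- `fst` is `C^∞`. [folklore] -/
theorem contMDiff_fst : ContMDiff (𝓡 (k + 2)) (𝓡 k) ∞ (fst : ProdC k N → N) :=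
  _root_.contMDiff_fst.comp contMDiff_out

/-- `snd` is `C^∞`. [folklore] -/
theorem contMDiff_snd : ContMDiff (𝓡 (k + 2)) 𝓘(ℝ, ℂ) ∞ (snd : ProdC k N → ℂ) :=
  _root_.contMDiff_snd.comp contMDiff_out

section Comp

variable {EX : Type*} [NormedAddCommGroup EX] [NormedSpace ℝ EX] {HX : Type*} [TopologicalSpace HX]
  {IX : ModelWithCorners ℝ EX HX} {X : Type*} [TopologicalSpace X] [ChartedSpace HX X]

/-- `x ↦ mk (g x) (h x)` is `C^∞` at `x` when `g`, `h` are. [folklore] -/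
theorem _root_.ContMDiffAt.prodC_mk {g : X → N} {h : X → ℂ} {x : X}
    (hg : ContMDiffAt IX (𝓡 k) ∞ g x) (hh : ContMDiffAt IX 𝓘(ℝ, ℂ) ∞ h x) :
    ContMDiffAt IX (𝓡 (k + 2)) ∞ (fun x => (mk (g x) (h x) : ProdC k N)) x :=
  (contMDiff_mkUncurry (N := N) (g x, h x)).comp x (hg.prodMk hh)

/-- `x ↦ mk (g x) (h x)` is `C^∞` on `s` when `g`, `h` are. [folklore] -/
theorem _root_.ContMDiffOn.prodC_mk {g : X → N} {h : X → ℂ} {s : Set X}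
    (hg : ContMDiffOn IX (𝓡 k) ∞ g s) (hh : ContMDiffOn IX 𝓘(ℝ, ℂ) ∞ h s) :
    ContMDiffOn IX (𝓡 (k + 2)) ∞ (fun x => (mk (g x) (h x) : ProdC k N)) s :=
  contMDiff_mkUncurry.comp_contMDiffOn (hg.prodMk hh)

/-- `x ↦ mk (g x) (h x)` is `C^∞` when `g`, `h` are. [folklore] -/
theorem _root_.ContMDiff.prodC_mk {g : X → N} {h : X → ℂ}
    (hg : ContMDiff IX (𝓡 k) ∞ g) (hh : ContMDiff IX 𝓘(ℝ, ℂ) ∞ h) :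
    ContMDiff IX (𝓡 (k + 2)) ∞ (fun x => (mk (g x) (h x) : ProdC k N)) :=
  contMDiff_mkUncurry.comp (hg.prodMk hh)

end Comp

/-! #### Differentials -/

/-- **The tangent frame of `ProdC k N`**: the tangent vector at `mk n w` with components
`v ∈ T_n N = ℝᵏ`, `z ∈ T_w ℂ = ℂ`, namely `L (v, z)` for the change of model `L`. [folklore] -/
def tangentLift (k : ℕ) (v : EuclideanSpace ℝ (Fin k)) (z : ℂ) : EuclideanSpace ℝ (Fin (k + 2)) :=
  prodCModelIso k (v, z)

/-- `tangentLift` is the linear isomorphism `L` on pairs. [folklore] -/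
theorem tangentLift_eq (v : EuclideanSpace ℝ (Fin k)) (z : ℂ) :
    tangentLift k v z = prodCModelIso k (v, z) := rfl

/-- Every tangent vector of `ProdC k N` is a `tangentLift`. [folklore] -/
theorem tangentLift_symm (u : EuclideanSpace ℝ (Fin (k + 2))) :
    tangentLift k ((prodCModelIso k).symm u).1 ((prodCModelIso k).symm u).2 = u := by
  rw [tangentLift_eq, Prod.mk.eta, ContinuousLinearEquiv.apply_symm_apply]

/-- `tangentLift` is additive. [folklore] -/
theorem tangentLift_add (v v' : EuclideanSpace ℝ (Fin k)) (z z' : ℂ) :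
    tangentLift k (v + v') (z + z') = tangentLift k v z + tangentLift k v' z' := by
  rw [tangentLift_eq, tangentLift_eq, tangentLift_eq, ← map_add, Prod.mk_add_mk]

/-- `tangentLift` is homogeneous. [folklore] -/
theorem tangentLift_smul (c : ℝ) (v : EuclideanSpace ℝ (Fin k)) (z : ℂ) :
    tangentLift k (c • v) (c • z) = c • tangentLift k v z := by
  rw [tangentLift_eq, tangentLift_eq, ← map_smul, Prod.smul_mk]

/-- `tangentLift v z = 0 ↔ v = 0 ∧ z = 0`. [folklore] -/
theorem tangentLift_eq_zero_iff {v : EuclideanSpace ℝ (Fin k)} {z : ℂ} :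
    tangentLift k v z = 0 ↔ v = 0 ∧ z = 0 := by
  rw [tangentLift_eq, (prodCModelIso k).map_eq_zero_iff, Prod.mk_eq_zero]

/-- **`d(mk)` is `L`**: the differential of `(n, w) ↦ mk n w` at `(n, w)` is the change of
model `L`. [folklore] -/
theorem hasMFDerivAt_mkUncurry (x : N × ℂ) :
    HasMFDerivAt ((𝓡 k).prod 𝓘(ℝ, ℂ)) (𝓡 (k + 2)) (fun p : N × ℂ => (mk p.1 p.2 : ProdC k N)) x
      (prodCModelIso k : (EuclideanSpace ℝ (Fin k) × ℂ) →L[ℝ] EuclideanSpace ℝ (Fin (k + 2))) :=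
  Rechart.hasMFDerivAt_into _ _ (prodCModelIso k) (fun _ ↦ rfl) x

/-- `mfderiv` of `(n, w) ↦ mk n w` is `L`. [folklore] -/
theorem mfderiv_mkUncurry (x : N × ℂ) :
    mfderiv ((𝓡 k).prod 𝓘(ℝ, ℂ)) (𝓡 (k + 2)) (fun p : N × ℂ => (mk p.1 p.2 : ProdC k N)) x =
      (prodCModelIso k : (EuclideanSpace ℝ (Fin k) × ℂ) →L[ℝ] EuclideanSpace ℝ (Fin (k + 2))) :=
  (hasMFDerivAt_mkUncurry x).mfderiv

/-- **`d(out)` is `L.symm`.** [folklore] -/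
theorem hasMFDerivAt_out (p : ProdC k N) :
    HasMFDerivAt (𝓡 (k + 2)) ((𝓡 k).prod 𝓘(ℝ, ℂ)) (Rechart.out (prodCModel k) (N × ℂ)) p
      ((prodCModelIso k).symm :
        EuclideanSpace ℝ (Fin (k + 2)) →L[ℝ] EuclideanSpace ℝ (Fin k) × ℂ) :=
  Rechart.hasMFDerivAt_out _ _ (prodCModelIso k) (fun _ ↦ rfl) p

/-- `d(fst)_{p} (L (v, z)) = v`. [folklore] -/
theorem hasMFDerivAt_fst (p : ProdC k N) :
    HasMFDerivAt (𝓡 (k + 2)) (𝓡 k) (fst : ProdC k N → N) p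
      ((ContinuousLinearMap.fst ℝ (EuclideanSpace ℝ (Fin k)) ℂ).comp
        ((prodCModelIso k).symm :
          EuclideanSpace ℝ (Fin (k + 2)) →L[ℝ] EuclideanSpace ℝ (Fin k) × ℂ)) := by
  have h1 : HasMFDerivAt ((𝓡 k).prod 𝓘(ℝ, ℂ)) (𝓡 k) (Prod.fst : N × ℂ → N)
      (Rechart.out (prodCModel k) (N × ℂ) p)
      (ContinuousLinearMap.fst ℝ (EuclideanSpace ℝ (Fin k)) ℂ) := _root_.hasMFDerivAt_fst _
  exact h1.comp p (hasMFDerivAt_out p)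

/-- `d(snd)_{p} (L (v, z)) = z`. [folklore] -/
theorem hasMFDerivAt_snd (p : ProdC k N) :
    HasMFDerivAt (𝓡 (k + 2)) 𝓘(ℝ, ℂ) (snd : ProdC k N → ℂ) p
      ((ContinuousLinearMap.snd ℝ (EuclideanSpace ℝ (Fin k)) ℂ).comp
        ((prodCModelIso k).symm :
          EuclideanSpace ℝ (Fin (k + 2)) →L[ℝ] EuclideanSpace ℝ (Fin k) × ℂ)) := by
  have h1 : HasMFDerivAt ((𝓡 k).prod 𝓘(ℝ, ℂ)) 𝓘(ℝ, ℂ) (Prod.snd : N × ℂ → ℂ)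
      (Rechart.out (prodCModel k) (N × ℂ) p)
      (ContinuousLinearMap.snd ℝ (EuclideanSpace ℝ (Fin k)) ℂ) := _root_.hasMFDerivAt_snd _
  exact h1.comp p (hasMFDerivAt_out p)

/-- `d(fst) (tangentLift v z) = v`. [folklore] -/
@[simp] theorem mfderiv_fst_tangentLift (p : ProdC k N) (v : EuclideanSpace ℝ (Fin k)) (z : ℂ) :
    mfderiv (𝓡 (k + 2)) (𝓡 k) (fst : ProdC k N → N) p (tangentLift k v z) = v := by
  rw [(hasMFDerivAt_fst p).mfderiv, tangentLift_eq]
  show ((prodCModelIso k).symm (prodCModelIso k (v, z))).1 = v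
  rw [ContinuousLinearEquiv.symm_apply_apply]

/-- `d(snd) (tangentLift v z) = z`. [folklore] -/
@[simp] theorem mfderiv_snd_tangentLift (p : ProdC k N) (v : EuclideanSpace ℝ (Fin k)) (z : ℂ) :
    mfderiv (𝓡 (k + 2)) 𝓘(ℝ, ℂ) (snd : ProdC k N → ℂ) p (tangentLift k v z) = z := by
  rw [(hasMFDerivAt_snd p).mfderiv, tangentLift_eq]
  show ((prodCModelIso k).symm (prodCModelIso k (v, z))).2 = z
  rw [ContinuousLinearEquiv.symm_apply_apply]

/-- A tangent vector of `ProdC k N` is determined by its two projections. [folklore] -/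
theorem tangent_ext {p : ProdC k N} {u u' : TangentSpace (𝓡 (k + 2)) p}
    (h1 : mfderiv (𝓡 (k + 2)) (𝓡 k) (fst : ProdC k N → N) p u =
      mfderiv (𝓡 (k + 2)) (𝓡 k) (fst : ProdC k N → N) p u')
    (h2 : mfderiv (𝓡 (k + 2)) 𝓘(ℝ, ℂ) (snd : ProdC k N → ℂ) p u =
      mfderiv (𝓡 (k + 2)) 𝓘(ℝ, ℂ) (snd : ProdC k N → ℂ) p u') : u = u' := by
  rw [(hasMFDerivAt_fst p).mfderiv] at h1
  rw [(hasMFDerivAt_snd p).mfderiv] at h2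
  have h1' : ((prodCModelIso k).symm u).1 = ((prodCModelIso k).symm u').1 := h1
  have h2' : ((prodCModelIso k).symm u).2 = ((prodCModelIso k).symm u').2 := h2
  have h : (prodCModelIso k).symm u = (prodCModelIso k).symm u' := Prod.ext h1' h2'
  have h' := congrArg (prodCModelIso k) h
  rwa [ContinuousLinearEquiv.apply_symm_apply, ContinuousLinearEquiv.apply_symm_apply] at h'

/-- Decomposition of a tangent vector of `ProdC k N` through the frame. [folklore] -/
theorem eq_tangentLift (p : ProdC k N) (u : TangentSpace (𝓡 (k + 2)) p) :
    u = tangentLift k (mfderiv (𝓡 (k + 2)) (𝓡 k) (fst : ProdC k N → N) p u)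
      (mfderiv (𝓡 (k + 2)) 𝓘(ℝ, ℂ) (snd : ProdC k N → ℂ) p u) := by
  apply tangent_ext
  · rw [mfderiv_fst_tangentLift]
  · rw [mfderiv_snd_tangentLift]

section CompDeriv

variable {EX : Type*} [NormedAddCommGroup EX] [NormedSpace ℝ EX] {HX : Type*} [TopologicalSpace HX]
  {IX : ModelWithCorners ℝ EX HX} {X : Type*} [TopologicalSpace X] [ChartedSpace HX X]

/-- **Chain rule into `ProdC k N`**: `d(mk (g ·) (h ·))_x v = tangentLift (dg v) (dh v)`.
[folklore] -/
theorem hasMFDerivAt_prodC_mk {g : X → N} {h : X → ℂ} {x : X}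
    {g' : TangentSpace IX x →L[ℝ] TangentSpace (𝓡 k) (g x)}
    {h' : TangentSpace IX x →L[ℝ] TangentSpace 𝓘(ℝ, ℂ) (h x)}
    (hg : HasMFDerivAt IX (𝓡 k) g x g') (hh : HasMFDerivAt IX 𝓘(ℝ, ℂ) h x h') :
    HasMFDerivAt IX (𝓡 (k + 2)) (fun x => (mk (g x) (h x) : ProdC k N)) x
      ((prodCModelIso k : (EuclideanSpace ℝ (Fin k) × ℂ) →L[ℝ]
        EuclideanSpace ℝ (Fin (k + 2))).comp (g'.prod h')) :=
  (hasMFDerivAt_mkUncurry (N := N) (g x, h x)).comp x (hg.prodMk hh)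

/-- Pointwise chain rule into `ProdC k N`. [folklore] -/
theorem mfderiv_prodC_mk_apply {g : X → N} {h : X → ℂ} {x : X}
    (hg : MDifferentiableAt IX (𝓡 k) g x) (hh : MDifferentiableAt IX 𝓘(ℝ, ℂ) h x)
    (v : TangentSpace IX x) :
    mfderiv IX (𝓡 (k + 2)) (fun x => (mk (g x) (h x) : ProdC k N)) x v =
      tangentLift k (mfderiv IX (𝓡 k) g x v) (mfderiv IX 𝓘(ℝ, ℂ) h x v) := by
  rw [(hasMFDerivAt_prodC_mk hg.hasMFDerivAt hh.hasMFDerivAt).mfderiv]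
  rfl

end CompDeriv

/-! ### The diagonal circle action -/

variable [MulAction Circle N]

omit [IsManifold (𝓡 k) ∞ N] in
/-- **The diagonal circle action on `ProdC k N`**: the product of the action on `N` with the
multiplication action of `S¹ ⊂ ℂ` on `ℂ` (Mathlib's `Prod.mulAction`, transported to the type
synonym). [cite: CannasdasilvaGuilleminPires2010, §2.3] -/
instance instMulAction : MulAction Circle (ProdC k N) :=
  inferInstanceAs (MulAction Circle (N × ℂ))

omit [IsManifold (𝓡 k) ∞ N] in
/-- `a • mk n w = mk (a • n) (a w)`. [folklore] -/
@[simp] theorem smul_mk (a : Circle) (n : N) (w : ℂ) :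
    a • (mk n w : ProdC k N) = mk (a • n) ((a : ℂ) * w) := rfl

omit [IsManifold (𝓡 k) ∞ N] in
/-- `fst (a • p) = a • fst p`. [folklore] -/
@[simp] theorem fst_smul (a : Circle) (p : ProdC k N) : fst (a • p) = a • fst p := rfl

omit [IsManifold (𝓡 k) ∞ N] in
/-- `snd (a • p) = a · snd p`. [folklore] -/
@[simp] theorem snd_smul (a : Circle) (p : ProdC k N) : snd (a • p) = (a : ℂ) * snd p := rfl

omit [IsManifold (𝓡 k) ∞ N] in
/-- **The diagonal action is free when the action on `N` is.** [folklore] -/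
theorem smul_eq_self_prodC (hfree : ∀ (a : Circle) (x : N), a • x = x → a = 1)
    (a : Circle) (p : ProdC k N) (h : a • p = p) : a = 1 :=
  hfree a (fst p) (by simpa using congrArg fst h)

omit [IsManifold (𝓡 k) ∞ N] in
/-- The norm of the `ℂ`-coordinate is invariant: `‖snd (a • p)‖ = ‖snd p‖`. [folklore] -/
@[simp] theorem norm_snd_smul (a : Circle) (p : ProdC k N) : ‖snd (a • p)‖ = ‖snd p‖ := by
  rw [snd_smul, norm_mul, Circle.norm_coe, one_mul]

/-- The multiplication action `S¹ × ℂ → ℂ` is `C^∞`. [folklore] -/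
theorem contMDiff_circle_mul_complex :
    ContMDiff ((𝓡 1).prod 𝓘(ℝ, ℂ)) 𝓘(ℝ, ℂ) ∞ fun x : Circle × ℂ => (x.1 : ℂ) * x.2 := by
  haveI : Fact (Module.finrank ℝ ℂ = 1 + 1) := finrank_real_complex_fact'
  have h₂ : ContMDiff (𝓘(ℝ, ℂ).prod 𝓘(ℝ, ℂ)) 𝓘(ℝ, ℂ) ∞ fun z : ℂ × ℂ => z.1 * z.2 := by
    rw [contMDiff_iff]
    exact ⟨continuous_mul, fun x y => contDiff_mul.contDiffOn⟩
  have hc : ContMDiff (𝓡 1) 𝓘(ℝ, ℂ) ∞ (fun z : Circle => (z : ℂ)) := contMDiff_coe_sphere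
  exact h₂.comp (ContMDiff.prodMap hc contMDiff_id)

/-- **The diagonal action is `C^∞` when the action on `N` is.** [folklore] -/
theorem contMDiff_smul_prodC
    (hθ : ContMDiff ((𝓡 1).prod (𝓡 k)) (𝓡 k) ∞ (fun x : Circle × N => x.1 • x.2)) :
    ContMDiff ((𝓡 1).prod (𝓡 (k + 2))) (𝓡 (k + 2)) ∞ (fun x : Circle × ProdC k N => x.1 • x.2) := by
  -- `a • p = mk (a • fst p) (a * snd p)`
  have heq : (fun x : Circle × ProdC k N => x.1 • x.2) =
      fun x : Circle × ProdC k N => (mk (x.1 • fst x.2) ((x.1 : ℂ) * snd x.2) : ProdC k N) := by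
    funext x
    rfl
  rw [heq]
  have hF : ContMDiff ((𝓡 1).prod (𝓡 (k + 2))) (𝓡 k) ∞ fun x : Circle × ProdC k N => fst x.2 :=
    contMDiff_fst.comp _root_.contMDiff_snd
  have hS : ContMDiff ((𝓡 1).prod (𝓡 (k + 2))) 𝓘(ℝ, ℂ) ∞ fun x : Circle × ProdC k N => snd x.2 :=
    contMDiff_snd.comp _root_.contMDiff_snd
  have h1 : ContMDiff ((𝓡 1).prod (𝓡 (k + 2))) (𝓡 k) ∞ fun x : Circle × ProdC k N => x.1 • fst x.2 :=
    hθ.comp (_root_.contMDiff_fst.prodMk hF)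
  have h2 : ContMDiff ((𝓡 1).prod (𝓡 (k + 2))) 𝓘(ℝ, ℂ) ∞
      fun x : Circle × ProdC k N => (x.1 : ℂ) * snd x.2 :=
    contMDiff_circle_mul_complex.comp (_root_.contMDiff_fst.prodMk hS)
  exact h1.prodC_mk h2

/-- Each `a • ·` is `C^∞` on `ProdC k N`. [folklore] -/
theorem contMDiff_const_smul_prodC
    (hθ : ContMDiff ((𝓡 1).prod (𝓡 k)) (𝓡 k) ∞ (fun x : Circle × N => x.1 • x.2)) (a : Circle) :
    ContMDiff (𝓡 (k + 2)) (𝓡 (k + 2)) ∞ (fun p : ProdC k N => a • p) :=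
  (contMDiff_smul_prodC hθ).comp (contMDiff_const.prodMk contMDiff_id)

/-- The diagonal action is continuous when the action on `N` is. [folklore] -/
theorem continuousSMul_prodC
    (hθ : ContMDiff ((𝓡 1).prod (𝓡 k)) (𝓡 k) ∞ (fun x : Circle × N => x.1 • x.2)) :
    ContinuousSMul Circle (ProdC k N) :=
  ⟨(contMDiff_smul_prodC hθ).continuous⟩

end ProdC

end Literature.Geometry.Manifold

end
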